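import Literature.Probability.RandomPlanarGeometry.LoewnerTransformContinuity
import HarnessLib

/-!
# Capacity clocks, analytic inputs: Loewner curves of a compact box do not stall, and boundary
# extensions converging on compacts are uniformly almost injective

Crux `Summit.CriticalPhenomena.CardyFormulaZ2.Theses.CardyUniqueLimit.CardyRigidity`
(stmt-CriticalPhenomena-0746), line `crossing_martingale`, stub A3a (capacity clock of the
bond-`ℤ²` exploration).  The two deterministic inputs of the estimate "one lattice step of the
exploration adds little half-plane capacity, uniformly off a small event":

* `exists_notMem_image_Icc`, `exists_two_notMem_image_Icc` — a curve generating a Loewner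
  chain (parametrised by half-plane capacity) visits, during every time interval `(T, T']`, at
  least two distinct points off its past `γ[0, T]` (equal traces give equal hulls, and a hull
  determines its capacity time, `Loewner.eq_of_hull_eq`; connectedness of `[T, T']`);
* `exists_nonstall` — **uniform non-stalling on a compact box of Loewner pairs**: for every
  horizon `L` and window `Δ > 0` there is `ρ > 0` such that every curve of the box has, in every
  window `[T, T + Δ]`, `T ≤ L`, two new points at distance `≥ ρ` (sequential compactness);
* `exists_almostInj` — if `Φ_k → Φ` uniformly on the compact half-discs `{0 ≤ im} ∩ B̄(0, R)`
  and `Φ` is the (injective, continuous) boundary extension of a chordal uniformizing map of a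
  Jordan domain, then eventually in `k`, points of the half-disc with `m`-close `Φ_k`-images are
  `ρ`-close.
-/

noncomputable section

open Filter Set Topology Metric
open scoped NNReal
open UpperHalfPlane (upperHalfPlaneSet)
open Literature.Probability.RandomPlanarGeometry

namespace Summit.CriticalPhenomena.CardyFormulaZ2.Cruxes.CardyRigidity.CrossingMartingale

namespace CapacityClock

/-! ### A capacity-parametrised curve does not stall -/

/-- **New points in every time interval.** If the chain of the continuous `W` is generated by
`γ`, then for `T < T'` some `γ s`, `s ∈ (T, T']`, lies off `γ[0, T]`: otherwise
`γ[0, T'] = γ[0, T]`, the hulls agree and `T' = T` (`Loewner.eq_of_hull_eq`).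
[cite: Lawler2005, Ch. 4 §4.1 Thm. 4.6] -/
theorem exists_notMem_image_Icc {W : ℝ≥0 → ℝ} {γ : ℝ≥0 → ℂ} (hW : Continuous W)
    (h : Loewner.IsGeneratedByCurve W γ) {T T' : ℝ≥0} (hTT' : T < T') :
    ∃ s ∈ Ioc T T', γ s ∉ γ '' Icc 0 T := by
  by_contra hcon
  push Not at hcon
  have himg : γ '' Icc 0 T' = γ '' Icc 0 T := by
    refine Subset.antisymm ?_ (image_mono (Icc_subset_Icc_right hTT'.le))
    rintro _ ⟨s, hs, rfl⟩
    rcases le_or_gt s T with hsT | hTs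
    · exact ⟨s, ⟨hs.1, hsT⟩, rfl⟩
    · exact hcon s ⟨hTs, hs.2⟩
  have hhull : Loewner.hull W T' = Loewner.hull W T := by rw [h.hull_eq, h.hull_eq, himg]
  exact hTT'.ne' (Loewner.eq_of_hull_eq hW hW hhull)

/-- **Two distinct new points in every time interval**: for `T < T'` the curve visits, at times
in `(T, T']`, two distinct points off `γ[0, T]` (if all new points coincided with one point `z`,
`[T, T']` would be covered by the disjoint closed sets `γ⁻¹(γ[0, T]) ∋ T` and `γ⁻¹{z}`).
[cite: Lawler2005, Ch. 4 §4.1] -/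
theorem exists_two_notMem_image_Icc {W : ℝ≥0 → ℝ} {γ : ℝ≥0 → ℂ} (hW : Continuous W)
    (h : Loewner.IsGeneratedByCurve W γ) {T T' : ℝ≥0} (hTT' : T < T') :
    ∃ s ∈ Ioc T T', ∃ s' ∈ Ioc T T',
      γ s ∉ γ '' Icc 0 T ∧ γ s' ∉ γ '' Icc 0 T ∧ γ s ≠ γ s' := by
  obtain ⟨s₁, hs₁, hnew₁⟩ := exists_notMem_image_Icc hW h hTT'
  by_contra hcon
  push Not at hcon
  have hγc : Continuous γ := h.1
  set A : Set ℝ≥0 := γ ⁻¹' (γ '' Icc 0 T) with hA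
  set B : Set ℝ≥0 := γ ⁻¹' {γ s₁} with hB
  have hAc : IsClosed A := (isCompact_Icc.image hγc).isClosed.preimage hγc
  have hBc : IsClosed B := isClosed_singleton.preimage hγc
  have hTA : T ∈ A := ⟨T, ⟨zero_le, le_rfl⟩, rfl⟩
  have hcover : Icc T T' ⊆ A ∪ B := by
    intro s hs
    rcases eq_or_lt_of_le hs.1 with rfl | hTs
    · exact Or.inl hTA
    · by_cases hold : γ s ∈ γ '' Icc 0 T
      · exact Or.inl hold
      · exact Or.inr (hcon s ⟨hTs, hs.2⟩ s₁ hs₁ hold hnew₁)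
  have hpre := isPreconnected_Icc (a := T) (b := T')
  rw [isPreconnected_closed_iff] at hpre
  obtain ⟨u, -, huA, huB⟩ := hpre A B hAc hBc hcover ⟨T, ⟨le_rfl, hTT'.le⟩, hTA⟩
    ⟨s₁, ⟨hs₁.1.le, hs₁.2⟩, rfl⟩
  have huB' : γ u = γ s₁ := huB
  exact hnew₁ (huB' ▸ huA)

/-- **Uniform non-stalling on a compact box of Loewner pairs.** Let `𝒦` be a compact set of
pairs `(γ̂, W)` with `γ̂` generating the chain of `W`. For every horizon `L` and window `Δ > 0`
there is `ρ > 0` such that for all `(γ̂, W) ∈ 𝒦` and `T ≤ L` the window `[T, T + Δ]` contains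
two times whose points are off `γ̂[0, T]` and at distance `≥ ρ` from each other. (By
contradiction: extract a convergent subsequence of bad pairs and windows; two new points of the
limit curve in the half-window stay new and apart for the nearby curves.)
[cite: KemppainenSmirnov2017, §3.5] -/
theorem exists_nonstall {𝒦 : Set (C(ℝ≥0, ℂ) × C(ℝ≥0, ℝ))} (h𝒦 : IsCompact 𝒦)
    (hgen : 𝒦 ⊆ generatedPairs) (L : ℝ≥0) {Δ : ℝ≥0} (hΔ : 0 < Δ) :
    ∃ ρ : ℝ, 0 < ρ ∧ ∀ p ∈ 𝒦, ∀ T ≤ L, ∃ s ∈ Icc T (T + Δ), ∃ s' ∈ Icc T (T + Δ),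
      p.1 s ∉ p.1 '' Icc 0 T ∧ p.1 s' ∉ p.1 '' Icc 0 T ∧ ρ ≤ dist (p.1 s) (p.1 s') := by
  by_contra H
  push Not at H
  choose ps hps Ts hTs hsmall using fun j : ℕ ↦ H (1 / ((j : ℝ) + 1)) (by positivity)
  -- a convergent subsequence of pairs, then of window starts
  obtain ⟨p, hp, φ₁, hφ₁, hlim₁⟩ := h𝒦.tendsto_subseq hps
  obtain ⟨T, hT, φ₂, hφ₂, hlim₂⟩ := (isCompact_Icc (a := (0 : ℝ≥0)) (b := L)).tendsto_subseq
    (x := Ts ∘ φ₁) fun j ↦ ⟨zero_le, hTs (φ₁ j)⟩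
  set ψ : ℕ → ℕ := φ₁ ∘ φ₂ with hψdef
  have hψ : StrictMono ψ := hφ₁.comp hφ₂
  have hlimp : Tendsto (fun i ↦ ps (ψ i)) atTop (𝓝 p) := hlim₁.comp hφ₂.tendsto_atTop
  have hlimT : Tendsto (fun i ↦ ((Ts (ψ i) : ℝ≥0) : ℝ)) atTop (𝓝 (T : ℝ)) :=
    NNReal.tendsto_coe.2 hlim₂
  -- two distinct new points of the limit curve in the half-window
  have hgenp : Loewner.IsGeneratedByCurve p.2 p.1 := hgen hp
  have hγc : Continuous p.1 := p.1.continuous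
  have hΔ2 : T < T + Δ / 2 := lt_add_of_pos_right T (half_pos hΔ)
  obtain ⟨s, hs, s', hs', hnew, hnew', hne⟩ :=
    exists_two_notMem_image_Icc p.2.continuous hgenp hΔ2
  have hd₀ : 0 < dist (p.1 s) (p.1 s') := dist_pos.2 hne
  have hKc : IsCompact (p.1 '' Icc 0 T) := isCompact_Icc.image hγc
  have hKne : (p.1 '' Icc 0 T).Nonempty := ⟨p.1 T, T, ⟨zero_le, le_rfl⟩, rfl⟩
  have hdS : 0 < infDist (p.1 s) (p.1 '' Icc 0 T) :=
    (hKc.isClosed.notMem_iff_infDist_pos hKne).1 hnew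
  have hdS' : 0 < infDist (p.1 s') (p.1 '' Icc 0 T) :=
    (hKc.isClosed.notMem_iff_infDist_pos hKne).1 hnew'
  set e : ℝ := min (min (infDist (p.1 s) (p.1 '' Icc 0 T)) (infDist (p.1 s') (p.1 '' Icc 0 T)))
    (dist (p.1 s) (p.1 s')) / 4 with he_def
  have he : 0 < e := by positivity
  have he1 : 4 * e ≤ infDist (p.1 s) (p.1 '' Icc 0 T) := by
    rw [he_def]; linarith [min_le_left (min (infDist (p.1 s) (p.1 '' Icc 0 T))
      (infDist (p.1 s') (p.1 '' Icc 0 T))) (dist (p.1 s) (p.1 s')),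
      min_le_left (infDist (p.1 s) (p.1 '' Icc 0 T)) (infDist (p.1 s') (p.1 '' Icc 0 T))]
  have he2 : 4 * e ≤ infDist (p.1 s') (p.1 '' Icc 0 T) := by
    rw [he_def]; linarith [min_le_left (min (infDist (p.1 s) (p.1 '' Icc 0 T))
      (infDist (p.1 s') (p.1 '' Icc 0 T))) (dist (p.1 s) (p.1 s')),
      min_le_right (infDist (p.1 s) (p.1 '' Icc 0 T)) (infDist (p.1 s') (p.1 '' Icc 0 T))]
  have he3 : 4 * e ≤ dist (p.1 s) (p.1 s') := by
    rw [he_def]; linarith [min_le_right (min (infDist (p.1 s) (p.1 '' Icc 0 T))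
      (infDist (p.1 s') (p.1 '' Icc 0 T))) (dist (p.1 s) (p.1 s'))]
  -- continuity of the limit curve at `T`
  obtain ⟨η, hη, hηe⟩ := Metric.continuous_iff.1 hγc T e he
  -- uniform convergence of the subsequence on `[0, L + Δ]`
  have hunif : ∀ᶠ i in atTop, ∀ u ∈ Icc (0 : ℝ≥0) (L + Δ), dist ((ps (ψ i)).1 u) (p.1 u) < e := by
    have h1 : Tendsto (fun i ↦ (ps (ψ i)).1) atTop (𝓝 p.1) := (continuous_fst.tendsto p).comp hlimp
    rw [ContinuousMap.tendsto_iff_tendstoLocallyUniformly,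
      tendstoLocallyUniformly_iff_forall_isCompact] at h1
    have h2 := Metric.tendstoUniformlyOn_iff.1 (h1 (Icc 0 (L + Δ)) isCompact_Icc) e he
    filter_upwards [h2] with i hi u hu
    rw [dist_comm]
    exact hi u hu
  -- the window starts converge to `T`
  have hsT : (T : ℝ) < min (s : ℝ) (s' : ℝ) := lt_min (by exact_mod_cast hs.1) (by exact_mod_cast hs'.1)
  have hev1 : ∀ᶠ i in atTop, ((Ts (ψ i) : ℝ≥0) : ℝ) < min (s : ℝ) (s' : ℝ) :=
    hlimT.eventually (gt_mem_nhds hsT)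
  have hΔpos : (0 : ℝ) < (Δ : ℝ) := by exact_mod_cast hΔ
  have hev2 : ∀ᶠ i in atTop, (T : ℝ) - (Δ : ℝ) / 2 < ((Ts (ψ i) : ℝ≥0) : ℝ) :=
    hlimT.eventually (lt_mem_nhds (by linarith))
  have hev3 : ∀ᶠ i in atTop, ((Ts (ψ i) : ℝ≥0) : ℝ) < T + η / 2 :=
    hlimT.eventually (gt_mem_nhds (by linarith))
  obtain ⟨i₀, hi₀⟩ := exists_nat_one_div_lt (half_pos hd₀)
  obtain ⟨i, ⟨⟨hiu, hi1⟩, hi2, hi3⟩, hii₀⟩ :=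
    (((hunif.and hev1).and (hev2.and hev3)).and (eventually_ge_atTop i₀)).exists
  set q := ps (ψ i) with hq
  set Tq : ℝ≥0 := Ts (ψ i) with hTq
  have hTqL : Tq ≤ L := hTs (ψ i)
  have hsL : ∀ {r : ℝ≥0}, r ∈ Ioc T (T + Δ / 2) → r ∈ Icc (0 : ℝ≥0) (L + Δ) := fun {r} hr ↦
    ⟨zero_le, hr.2.trans (by
      have : T + Δ / 2 ≤ L + Δ := add_le_add hT.2 ((NNReal.half_le_self _))
      exact this)⟩
  -- membership of `s`, `s'` in the window of `q`
  have hwin : ∀ {r : ℝ≥0}, r ∈ Ioc T (T + Δ / 2) → (Tq : ℝ) < r → r ∈ Icc Tq (Tq + Δ) := by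
    intro r hr hlt
    refine ⟨by exact_mod_cast hlt.le, ?_⟩
    have h1 : ((r : ℝ≥0) : ℝ) ≤ (T : ℝ) + (Δ : ℝ) / 2 := by
      have := hr.2
      exact_mod_cast this
    have h2 : (T : ℝ) - (Δ : ℝ) / 2 < Tq := hi2
    have h3 : ((r : ℝ≥0) : ℝ) ≤ (Tq : ℝ) + (Δ : ℝ) := by linarith
    exact_mod_cast h3
  have hsw : s ∈ Icc Tq (Tq + Δ) := hwin hs (hi1.trans_le (min_le_left _ _))
  have hs'w : s' ∈ Icc Tq (Tq + Δ) := hwin hs' (hi1.trans_le (min_le_right _ _))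
  -- new points of the limit stay new for `q`
  have hstay : ∀ {r : ℝ≥0}, r ∈ Ioc T (T + Δ / 2) → 4 * e ≤ infDist (p.1 r) (p.1 '' Icc 0 T) →
      q.1 r ∉ q.1 '' Icc 0 Tq := by
    intro r hr hfar hmem
    obtain ⟨u, hu, hqu⟩ := hmem
    have huL : u ∈ Icc (0 : ℝ≥0) (L + Δ) :=
      ⟨zero_le, hu.2.trans (hTqL.trans (le_add_of_nonneg_right (zero_le)))⟩
    have h1 : dist (q.1 r) (p.1 r) < e := hiu r (hsL hr)
    have h2 : dist (q.1 u) (p.1 u) < e := hiu u huL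
    have h3 : dist (p.1 r) (p.1 u) < 2 * e :=
      calc dist (p.1 r) (p.1 u) ≤ dist (p.1 r) (q.1 r) + dist (q.1 r) (p.1 u) := dist_triangle _ _ _
        _ = dist (q.1 r) (p.1 r) + dist (q.1 u) (p.1 u) := by rw [dist_comm (p.1 r), hqu]
        _ < 2 * e := by linarith
    -- `p.1 u` is within `e` of `p.1 '' Icc 0 T`
    have h4 : infDist (p.1 r) (p.1 '' Icc 0 T) < 3 * e := by
      rcases le_or_gt u T with huT | hTu
      · have := infDist_le_dist_of_mem (x := p.1 r)
          (mem_image_of_mem p.1 (show u ∈ Icc 0 T from ⟨zero_le, huT⟩))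
        linarith
      · have hdu : dist u T < η := by
          rw [NNReal.dist_eq, abs_sub_lt_iff]
          have hu2 : ((u : ℝ≥0) : ℝ) ≤ Tq := by exact_mod_cast hu.2
          have hTu' : (T : ℝ) < u := by exact_mod_cast hTu
          constructor <;> linarith [hi3]
        have h5 : dist (p.1 u) (p.1 T) < e := hηe u hdu
        have h6 := infDist_le_dist_of_mem (x := p.1 r)
          (mem_image_of_mem p.1 (show T ∈ Icc 0 T from ⟨zero_le, le_rfl⟩))
        linarith [dist_triangle (p.1 r) (p.1 u) (p.1 T)]
    linarith
  have hqnew : q.1 s ∉ q.1 '' Icc 0 Tq := hstay hs he1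
  have hqnew' : q.1 s' ∉ q.1 '' Icc 0 Tq := hstay hs' he2
  -- the contradiction: `q.1 s`, `q.1 s'` are `1/(ψ i + 1)`-close but `≥ d₀ / 2` apart
  have hclose : dist (q.1 s) (q.1 s') < 1 / ((ψ i : ℝ) + 1) := hsmall (ψ i) s hsw s' hs'w hqnew hqnew'
  have hψi : (i : ℝ) ≤ ψ i := by exact_mod_cast hψ.id_le i
  have hi₀' : (i₀ : ℝ) ≤ i := by exact_mod_cast hii₀
  have hrate : 1 / ((ψ i : ℝ) + 1) ≤ 1 / ((i₀ : ℝ) + 1) :=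
    one_div_le_one_div_of_le (by positivity) (by linarith)
  have hfar : dist (p.1 s) (p.1 s') - 2 * e ≤ dist (q.1 s) (q.1 s') := by
    have h1 : dist (q.1 s) (p.1 s) < e := hiu s (hsL hs)
    have h2 : dist (q.1 s') (p.1 s') < e := hiu s' (hsL hs')
    linarith [dist_triangle4 (p.1 s) (q.1 s) (q.1 s') (p.1 s'), dist_comm (q.1 s) (p.1 s)]
  linarith

/-! ### Almost injectivity of converging boundary extensions -/

/-- **Uniform almost-injectivity.** Let `Φ` be the boundary extension of a conformal map of `ℍ`
onto a Jordan domain (injective and continuous on `{0 ≤ im}`, Carathéodory) and `Φ_k → Φ`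
uniformly on `{0 ≤ im} ∩ B̄(0, R)` ((U1)). Then for every `ρ > 0` there is `m > 0` such that,
eventually in `k`, any two points of that compact half-disc whose `Φ_k`-images are `m`-close are
`ρ`-close (the inverse of `Φ` is uniformly continuous on the compact image, and the `Φ_k` are
uniformly close to `Φ`). [cite: PommerenkeBBCM1992, Thm. 2.6] -/
theorem exists_almostInj {D : DobrushinDomain} {φ : ConformalEquiv upperHalfPlaneSet D.carrier}
    {Φs : ℕ → ℂ → ℂ} {R : ℝ}
    (hU1 : TendstoUniformlyOn Φs φ.boundaryExtension atTop ({z : ℂ | 0 ≤ z.im} ∩ closedBall 0 R))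
    {ρ : ℝ} (hρ : 0 < ρ) :
    ∃ m : ℝ, 0 < m ∧ ∀ᶠ k in atTop, ∀ z w : ℂ, 0 ≤ z.im → ‖z‖ ≤ R → 0 ≤ w.im → ‖w‖ ≤ R →
      dist (Φs k z) (Φs k w) < m → dist z w < ρ := by
  set K : Set ℂ := {z : ℂ | 0 ≤ z.im} ∩ closedBall 0 R with hK
  have hKc : IsCompact K :=
    (isCompact_closedBall (0 : ℂ) R).inter_left (isClosed_le continuous_const Complex.continuous_im)
  set S : Set (ℂ × ℂ) := (K ×ˢ K) ∩ {q : ℂ × ℂ | ρ ≤ dist q.1 q.2} with hS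
  have hSc : IsCompact S := (hKc.prod hKc).inter_right (isClosed_le continuous_const continuous_dist)
  set Φ := φ.boundaryExtension with hΦ
  have hΦc : ContinuousOn Φ {z : ℂ | 0 ≤ z.im} := continuousOn_boundaryExtension_im_nonneg φ
  have hF : ContinuousOn (fun q : ℂ × ℂ ↦ dist (Φ q.1) (Φ q.2)) S := by
    have h1 : ContinuousOn (fun q : ℂ × ℂ ↦ Φ q.1) S :=
      hΦc.comp continuous_fst.continuousOn fun q hq ↦ hq.1.1.1
    have h2 : ContinuousOn (fun q : ℂ × ℂ ↦ Φ q.2) S :=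
      hΦc.comp continuous_snd.continuousOn fun q hq ↦ hq.1.2.1
    exact continuous_dist.comp_continuousOn (h1.prodMk h2)
  have hinj := JordanDomain.injOn_boundaryExtension φ
  obtain ⟨m₀, hm₀, hm₀S⟩ : ∃ m₀ : ℝ, 0 < m₀ ∧ ∀ q ∈ S, m₀ ≤ dist (Φ q.1) (Φ q.2) := by
    by_cases hne : S.Nonempty
    · obtain ⟨q₀, hq₀, hmin⟩ := hSc.exists_isMinOn hne hF
      refine ⟨_, dist_pos.2 fun heq ↦ ?_, fun q hq ↦ hmin hq⟩
      have h1 : q₀.1 = q₀.2 := hinj hq₀.1.1.1 hq₀.1.2.1 heq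
      have h2 : ρ ≤ dist q₀.1 q₀.2 := hq₀.2
      rw [h1, dist_self] at h2
      exact absurd h2 (not_le.2 hρ)
    · exact ⟨1, one_pos, fun q hq ↦ (hne ⟨q, hq⟩).elim⟩
  refine ⟨m₀ / 3, by positivity, ?_⟩
  filter_upwards [Metric.tendstoUniformlyOn_iff.1 hU1 (m₀ / 3) (by positivity)] with k hk z w hz
    hzR hw hwR hdist
  by_contra hfar
  push Not at hfar
  have hzK : z ∈ K := ⟨hz, mem_closedBall_zero_iff.2 hzR⟩
  have hwK : w ∈ K := ⟨hw, mem_closedBall_zero_iff.2 hwR⟩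
  have h1 := hm₀S (z, w) ⟨⟨hzK, hwK⟩, hfar⟩
  have h2 := hk z hzK
  have h3 := hk w hwK
  linarith [dist_triangle4 (Φ z) (Φs k z) (Φs k w) (Φ w), dist_comm (Φs k w) (Φ w)]

end CapacityClock

/-- **Uniform non-stalling on a compact box of Loewner pairs** (registered glue form of
`CapacityClock.exists_nonstall`): for every horizon `L` and window `Δ > 0` there is `ρ > 0`
such that every curve of the box has, in every window `[T, T + Δ]` with `T ≤ L`, two points off
its past `γ̂[0, T]` at mutual distance `≥ ρ`. [cite: KemppainenSmirnov2017, §3.5] -/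
theorem capClock_exists_nonstall : ∀ {𝒦 : Set (C(ℝ≥0, ℂ) × C(ℝ≥0, ℝ))}, IsCompact 𝒦 → 𝒦 ⊆ generatedPairs → ∀ (L : ℝ≥0) {Δ : ℝ≥0}, 0 < Δ → ∃ ρ : ℝ, 0 < ρ ∧ ∀ p ∈ 𝒦, ∀ T ≤ L, ∃ s ∈ Icc T (T + Δ), ∃ s' ∈ Icc T (T + Δ), p.1 s ∉ p.1 '' Icc 0 T ∧ p.1 s' ∉ p.1 '' Icc 0 T ∧ ρ ≤ dist (p.1 s) (p.1 s') :=
  fun h𝒦 hgen L _ hΔ ↦ CapacityClock.exists_nonstall h𝒦 hgen L hΔ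

end Summit.CriticalPhenomena.CardyFormulaZ2.Cruxes.CardyRigidity.CrossingMartingale

end
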